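import Summits.Parity.GeneralizedHardyLittlewood.Theorems.LiouvilleShiftedTablesTypeI2DilatedPeel3

/-!
# The peel, part 4/6: the per-pair bound

Route `LiouvilleShiftedTables` (Parity / GeneralizedHardyLittlewood), crux `TypeI2Dilated` (stmt-Parity-14272),
line `peel-to-drappeau`, registered stub `stub_peel : PeelStep` (`PeelStep := DrappeauTypeII → DilatedTypeIICore`,
vocabulary in `…Theorems.LiouvilleShiftedTablesDefs`).  THE PEEL moves the two rough moduli
(`r` and the dilation `q`, both `≤ x^ρ`) and their classes onto the coefficients, so that Drappeau's
hypothesis-free Theorem 5.1 (S. Drappeau, Proc. LMS 114 (2017), arXiv:1504.05549, §5 — the Literature named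
fact `Drappeau2017_theorem51`, taken as the hypothesis `DrappeauTypeII`) applies on the smooth modulus `s` alone:
CRT class `e mod lcm(q, r)` → `g ∣ mh` × a unit class expanded in characters `ξ mod L'` (absorbed into `α`, `β`),
the `(qr)^∞`-part `h` of the `β`-variable split off (`h ≤ x^{6ρ₀}`: Theorem 5.1 at `x' = MN/h` with
`a₁ = c·qr`, `a₂ = h·qr`; `h > x^{6ρ₀}`: the trivial bound (5.2) and `∑_{h ∣ (qr)^∞} h^{-1/2} ≤ τ(qr)²`),
`ρ₀ = min(δ_{5.1}(η/2), η)/100`.  Everything here is PROVED; the only non-Mathlib inputs are the Literature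
lemmas `Literature.NumberTheory.Sieve.DrappeauDispersionLemmas` (all proved) and the divisor bound
(`DivisorBound`, `DivisorPowerSums`).

The chain (each file imports the previous one):
* part 1: the peeled objects and THE PEEL identity (`…TypeI2DilatedPeel1`)
* part 2: matching Theorem 5.1; bounds for the peeled coefficients and blocks (`…TypeI2DilatedPeel2`)
* part 3: CRT, from blocks to the pair, and the main blocks via Theorem 5.1 (`…TypeI2DilatedPeel3`)
* part 4: the per-pair bound (`…TypeI2DilatedPeel4`)
* part 5: the crux sum at one height `x` (`…TypeI2DilatedPeel5`)
* part 6: constants, thresholds and `stub_peel` (`…TypeI2DilatedPeel6`)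

[this line; cite: Drappeau2017, Thm 5.1, §5 (5.1)–(5.2)]
-/

noncomputable section

namespace Summit.Parity.GeneralizedHardyLittlewood.Cruxes.TypeI2Dilated.PeelToDrappeau

open Finset Real
open scoped ArithmeticFunction.sigma Classical
open Literature.NumberTheory.Sieve Literature.NumberTheory.Sieve.Drappeau2017

/-! ### The per-pair bound -/

/-- `h^{-1/2} = h^{1/2}/h` for `h > 0`. [folklore] -/
theorem rpow_neg_half_eq {t : ℝ} (ht : 0 < t) : t ^ (-(1 / 2 : ℝ)) = t ^ (1 / 2 : ℝ) / t := by
  rw [show (-(1 / 2 : ℝ)) = (1 / 2 : ℝ) - 1 by norm_num, Real.rpow_sub ht, Real.rpow_one]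

/-- `1/h ≤ H^{-1/2} h^{-1/2}` for `h ≥ H > 0`. [folklore] -/
theorem inv_le_rpow_mul_rpow {H t : ℝ} (hH : 0 < H) (hHt : H ≤ t) :
    t⁻¹ ≤ H ^ (-(1 / 2 : ℝ)) * t ^ (-(1 / 2 : ℝ)) := by
  have ht : 0 < t := hH.trans_le hHt
  have e1 : t⁻¹ = t ^ (-(1 / 2 : ℝ)) * t ^ (-(1 / 2 : ℝ)) := by
    rw [← Real.rpow_add ht, show (-(1 / 2 : ℝ)) + (-(1 / 2 : ℝ)) = -1 by norm_num,
      Real.rpow_neg_one]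
  rw [e1]
  refine mul_le_mul_of_nonneg_right ?_ (by positivity)
  exact Real.rpow_le_rpow_of_nonpos hH hHt (by norm_num)

section WithTheorem51

/-! The section hypothesis `h51`: Drappeau's Theorem 5.1 at fixed `(η₅, δ, K, C₅, c₀, x₅)` — literally the
inner statement of `Literature.NumberTheory.Sieve.Drappeau2017_theorem51` once its quantifiers
`∀ η ∃ δ ∀ A ∃ C c₀ x₀` are instantiated. -/

variable {η₅ δ K C₅ c₀ x₅ : ℝ}
  (h51 : ∀ x : ℝ, x₅ ≤ x →
    ∀ M N S Rd : ℝ, M * N = x → x ^ η₅ ≤ N → N ≤ S ^ (2 / 3 - η₅) → x ^ (1 / 4 : ℝ) ≤ S →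
      S ≤ x ^ (1 / 2 + δ) → 1 ≤ Rd → Rd ≤ x ^ δ →
    ∀ a₁ a₂ : ℤ, a₁ ≠ 0 → a₂ ≠ 0 → (|a₁| : ℝ) ≤ x ^ δ → (|a₂| : ℝ) ≤ x ^ δ →
    ∀ α β : ℕ → ℂ, (∀ m, ‖α m‖ ≤ (σ 0 m : ℝ) ^ K) → (∀ n, ‖β n‖ ≤ (σ 0 n : ℝ) ^ K) →
      ‖∑ s ∈ (BFI.dyadic S).filter (fun s : ℕ => IsCoprime (s : ℤ) (a₁ * a₂)),
          ∑ m ∈ BFI.dyadic M, ∑ n ∈ (BFI.dyadic N).filter (fun n : ℕ => IsCoprime (n : ℤ) a₂),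
            α m * β n *
              uR Rd s (((m * n : ℕ) : ZMod s) * ((a₁ : ZMod s))⁻¹ * ((a₂ : ZMod s)))‖ ≤
        C₅ * x * Real.log x ^ c₀ / Rd)
include h51

/-- **The per-pair bound**: for a compatible pair `(q, r)` with class `e mod L`, `L = lcm(q, r)`,
`‖T_L‖ ≤ τ(qr)² · MN · (C₁ Λ₁/Rd + 4 D_K² (D + Rd Λ₂) H^{-1/2})`: the blocks `h ≤ H` by Theorem 5.1
(its side conditions at `x' = MN/h` being the hypothesis `hnum`), the blocks `h > H` trivially, and
`∑_{h ∣ (qr)^∞} h^{-1/2} ≤ τ(qr)²`. [this line] -/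
theorem norm_TL_le (hK : 0 ≤ K)
    {c : ℤ} (hc : c ≠ 0) {Rd : ℝ} (hRd : 1 ≤ Rd) {q r : ℕ} (hq : 0 < q) (hr : 0 < r)
    {Slo : ℝ} (hSlo : 0 ≤ Slo) {M N : ℝ} (hM : 0 ≤ M) (hN : 0 ≤ N) (hcMN : (|c| : ℝ) < M * N)
    {α β : ℕ → ℂ} (hα : ∀ m, ‖α m‖ ≤ (σ 0 m : ℝ) ^ K) (hβ : ∀ n, ‖β n‖ ≤ (σ 0 n : ℝ) ^ K)
    {L e B : ℕ} (hLdef : L = Nat.lcm q r) (hB : ⌊2 * N⌋₊ ≤ B)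
    {H Λ₁ C₁ D DK Λ₂ X : ℝ} (hH : 1 ≤ H) (hΛ₁ : 0 ≤ Λ₁) (hC₁ : 0 ≤ C₁) (hD : 1 ≤ D)
    (hDK : 0 ≤ DK) (hΛ₂ : 0 ≤ Λ₂)
    (hnum : ∀ h ∈ hSet (q * r) B, (h : ℝ) ≤ H →
        x₅ ≤ M * (N / h) ∧ (M * (N / h)) ^ η₅ ≤ N / h ∧ N / h ≤ Slo ^ (2 / 3 - η₅) ∧
        (M * (N / h)) ^ (1 / 4 : ℝ) ≤ Slo ∧ Slo ≤ (M * (N / h)) ^ (1 / 2 + δ) ∧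
        Rd ≤ (M * (N / h)) ^ δ ∧ (|c| : ℝ) * ((q * r : ℕ) : ℝ) ≤ (M * (N / h)) ^ δ ∧
        ((h * (q * r) : ℕ) : ℝ) ≤ (M * (N / h)) ^ δ ∧
        C₅ * Real.log (M * (N / h)) ^ c₀ ≤ Λ₁)
    (hC₁h : ∀ h : ℕ, h ≠ 0 → (σ 0 h : ℝ) ^ K ≤ C₁ * (h : ℝ) ^ (1 / 2 : ℝ))
    (hXτ : ∀ n : ℕ, n ≠ 0 → (n : ℝ) ≤ X → (σ 0 n : ℝ) ≤ D)
    (hXK : ∀ n : ℕ, n ≠ 0 → (n : ℝ) ≤ X → (σ 0 n : ℝ) ^ K ≤ DK)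
    (hXM : 2 * M ≤ X) (hXN : 2 * N ≤ X) (hXk : 4 * (M * N) + |(c : ℝ)| ≤ X)
    (hΛ₂s : ∑ s ∈ Icc 1 ⌊2 * Slo⌋₊, (σ 0 s : ℝ) ^ 2 / s ≤ Λ₂) :
    ‖TL c Rd q r Slo M N α β L e‖ ≤
      (σ 0 (q * r) : ℝ) ^ 2 * (M * N) *
        (C₁ * Λ₁ / Rd + 4 * DK ^ 2 * (D + Rd * Λ₂) * H ^ (-(1 / 2 : ℝ))) := by
  have hP0 : q * r ≠ 0 := (Nat.mul_pos hq hr).ne'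
  have hRd0 : 0 < Rd := by linarith
  have hH0 : 0 < H := by linarith
  have hMN : 0 ≤ M * N := mul_nonneg hM hN
  set A : ℝ := C₁ * Λ₁ * (M * N) / Rd with hA
  set Bt : ℝ := 4 * (M * N) * DK ^ 2 * (D + Rd * Λ₂) * H ^ (-(1 / 2 : ℝ)) with hBt
  have hA0 : 0 ≤ A := by positivity
  have hDR : 0 ≤ D + Rd * Λ₂ := by positivity
  have hBt0 : 0 ≤ Bt := by positivity
  -- blockwise bound
  set b : ℕ → ℝ := fun h => (A + Bt) * (h : ℝ) ^ (-(1 / 2 : ℝ)) with hb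
  have key : ‖TL c Rd q r Slo M N α β L e‖ ≤ ∑ h ∈ hSet (q * r) B, b h := by
    refine norm_TL_le_sum c Rd hq hr Slo hN α β hLdef hB b fun h hh ξ => ?_
    have hh' := mem_hSet.1 hh
    have hh0 : h ≠ 0 := by omega
    have hhpos : (0 : ℝ) < h := by exact_mod_cast Nat.pos_of_ne_zero hh0
    have hhS := hh'.2
    by_cases hhH : (h : ℝ) ≤ H
    · -- main block, Theorem 5.1
      obtain ⟨h1, h2, h3, h4, h5, h7, h8, h9, hlog⟩ := hnum h hh hhH
      refine (main_block_bound h51 hK hc Rd hq hr hSlo M N hα hβ _ hh0 hhS ξ h1 h2 h3 h4 h5 hRd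
        h7 h8 h9).trans ?_
      have hy : M * (N / h) = M * N / h := by ring
      have hy0 : 0 ≤ M * (N / h) := by positivity
      calc (σ 0 h : ℝ) ^ K * (C₅ * (M * (N / h)) * Real.log (M * (N / h)) ^ c₀ / Rd)
          = (σ 0 h : ℝ) ^ K * (M * (N / h)) / Rd * (C₅ * Real.log (M * (N / h)) ^ c₀) := by ring
        _ ≤ (C₁ * (h : ℝ) ^ (1 / 2 : ℝ)) * (M * (N / h)) / Rd * Λ₁ := by
            have hleft : (σ 0 h : ℝ) ^ K * (M * (N / h)) / Rd ≤
                (C₁ * (h : ℝ) ^ (1 / 2 : ℝ)) * (M * (N / h)) / Rd :=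
              div_le_div_of_nonneg_right (mul_le_mul_of_nonneg_right (hC₁h h hh0) hy0) hRd0.le
            have hx : 0 ≤ (σ 0 h : ℝ) ^ K * (M * (N / h)) / Rd := by positivity
            rcases le_or_gt 0 (C₅ * Real.log (M * (N / h)) ^ c₀) with hpos | hneg
            · exact mul_le_mul hleft hlog hpos (by positivity)
            · calc (σ 0 h : ℝ) ^ K * (M * (N / h)) / Rd * (C₅ * Real.log (M * (N / h)) ^ c₀)
                  ≤ 0 := mul_nonpos_iff.2 (Or.inl ⟨hx, hneg.le⟩)
                _ ≤ _ := by positivity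
        _ = A * (h : ℝ) ^ (-(1 / 2 : ℝ)) := by
            rw [hA, rpow_neg_half_eq hhpos]
            field_simp
        _ ≤ b h := by
            rw [hb]
            exact mul_le_mul_of_nonneg_right (le_add_of_nonneg_right hBt0) (by positivity)
    · -- tail block, trivially
      push Not at hhH
      refine (tail_block_bound c Rd q r Slo M N α β (q * r) _ h _ ξ).trans ?_
      have hterm : ∀ m ∈ BFI.dyadic M, ∀ n ∈ (BFI.dyadic (N / h)).filter (fun n => n.Coprime (q * r)),
          ‖α m‖ * ‖β (h * n)‖ * ∑ s ∈ sRange c q r Slo (2 * Slo), ‖Fker c Rd s (m * (h * n))‖ ≤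
            DK * DK * (D + Rd * Λ₂) := by
        intro m hm n hn
        have hn' : h * n ∈ BFI.dyadic N :=
          (mul_mem_dyadic_iff hN (Nat.pos_of_ne_zero hh0) n).2 (Finset.mem_filter.1 hn).1
        obtain ⟨hmM, hm2⟩ := (BFI.mem_dyadic hM).1 hm
        obtain ⟨hnN, hn2⟩ := (BFI.mem_dyadic hN).1 hn'
        have hm0 : m ≠ 0 := (BFI.pos_of_mem_dyadic hM hm).ne'
        have hn0 : h * n ≠ 0 := (BFI.pos_of_mem_dyadic hN hn').ne'
        have hαm : ‖α m‖ ≤ DK := (hα m).trans (hXK m hm0 (hm2.trans hXM))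
        have hβn : ‖β (h * n)‖ ≤ DK := (hβ _).trans (hXK _ hn0 (hn2.trans hXN))
        -- the product `k = m (h n)` exceeds `MN > |c|`
        have hk_gt : M * N < ((m * (h * n) : ℕ) : ℝ) := by
          rw [Nat.cast_mul]
          exact mul_lt_mul'' hmM hnN hM hN
        have hk_le : ((m * (h * n) : ℕ) : ℝ) ≤ 4 * (M * N) := by
          rw [Nat.cast_mul]
          calc (m : ℝ) * ((h * n : ℕ) : ℝ) ≤ (2 * M) * (2 * N) :=
                mul_le_mul hm2 hn2 (Nat.cast_nonneg _) (by positivity)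
            _ = 4 * (M * N) := by ring
        have hkc : ((m * (h * n) : ℕ) : ℤ) ≠ c := by
          intro heq
          have : ((m * (h * n) : ℕ) : ℝ) = (c : ℝ) := by exact_mod_cast heq
          have := le_abs_self (c : ℝ)
          linarith
        have hF := sum_norm_Fker_le (le_trans zero_le_one hRd) q r Slo hkc
        have hnat0 : (((m * (h * n) : ℕ) : ℤ) - c).natAbs ≠ 0 := by
          rw [ne_eq, Int.natAbs_eq_zero, sub_eq_zero]; exact hkc
        have hnatX : (((((m * (h * n) : ℕ) : ℤ) - c).natAbs : ℕ) : ℝ) ≤ X := by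
          have e1 : (((((m * (h * n) : ℕ) : ℤ) - c).natAbs : ℕ) : ℝ) = |((m * (h * n) : ℕ) : ℝ) - c| := by
            rw [Nat.cast_natAbs]; push_cast; rfl
          rw [e1]
          refine (abs_sub _ _).trans ?_
          rw [Nat.abs_cast]
          linarith
        have hτ : (σ 0 ((((m * (h * n) : ℕ) : ℤ) - c).natAbs) : ℝ) ≤ D := hXτ _ hnat0 hnatX
        calc ‖α m‖ * ‖β (h * n)‖ * ∑ s ∈ sRange c q r Slo (2 * Slo), ‖Fker c Rd s (m * (h * n))‖
            ≤ DK * DK * ((σ 0 ((((m * (h * n) : ℕ) : ℤ) - c).natAbs) : ℝ) +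
                Rd * ∑ s ∈ Icc 1 ⌊2 * Slo⌋₊, (σ 0 s : ℝ) ^ 2 / s) :=
              mul_le_mul (mul_le_mul hαm hβn (norm_nonneg _) hDK) hF
                (Finset.sum_nonneg fun _ _ => norm_nonneg _) (by positivity)
          _ ≤ DK * DK * (D + Rd * Λ₂) := by
              refine mul_le_mul_of_nonneg_left (add_le_add hτ ?_) (by positivity)
              exact mul_le_mul_of_nonneg_left hΛ₂s hRd0.le
      refine (Finset.sum_le_sum fun m hm => Finset.sum_le_sum fun n hn => hterm m hm n hn).trans ?_
      rw [Finset.sum_const, Finset.sum_const, nsmul_eq_mul, nsmul_eq_mul]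
      have hcM := card_dyadic_le hM
      have hcN : (((BFI.dyadic (N / h)).filter (fun n => n.Coprime (q * r))).card : ℝ) ≤ 2 * (N / h) :=
        le_trans (by exact_mod_cast Finset.card_filter_le _ _) (card_dyadic_le (by positivity))
      calc ((BFI.dyadic M).card : ℝ) *
            ((((BFI.dyadic (N / h)).filter (fun n => n.Coprime (q * r))).card : ℝ) *
              (DK * DK * (D + Rd * Λ₂)))
          ≤ (2 * M) * ((2 * (N / h)) * (DK * DK * (D + Rd * Λ₂))) := by
            refine mul_le_mul hcM (mul_le_mul_of_nonneg_right hcN (by positivity)) (by positivity)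
              (by positivity)
        _ = 4 * (M * N) * DK ^ 2 * (D + Rd * Λ₂) * (h : ℝ)⁻¹ := by ring
        _ ≤ 4 * (M * N) * DK ^ 2 * (D + Rd * Λ₂) * (H ^ (-(1 / 2 : ℝ)) * (h : ℝ) ^ (-(1 / 2 : ℝ))) :=
            mul_le_mul_of_nonneg_left (inv_le_rpow_mul_rpow hH0 hhH.le) (by positivity)
        _ = Bt * (h : ℝ) ^ (-(1 / 2 : ℝ)) := by rw [hBt]; ring
        _ ≤ b h := by
            rw [hb]
            exact mul_le_mul_of_nonneg_right (le_add_of_nonneg_left hA0) (by positivity)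
  refine key.trans ?_
  rw [hb, ← Finset.mul_sum]
  calc (A + Bt) * ∑ h ∈ hSet (q * r) B, (h : ℝ) ^ (-(1 / 2 : ℝ))
      ≤ (A + Bt) * (σ 0 (q * r) : ℝ) ^ 2 :=
        mul_le_mul_of_nonneg_left (sum_hSet_rpow_le hP0 B) (add_nonneg hA0 hBt0)
    _ = _ := by rw [hA, hBt]; ring

end WithTheorem51

/-- Landing anchor of the split peel chain (file 4 of 6): a registered, mathematically vacuous sub-goal
(`ledger workitem stub-add … --name peelChain4_anchor --signature 'True'`) so that this intermediate file passes
the gate's supports check; the registered stub `stub_peel` is proved in file 6. [this line] -/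
theorem peelChain4_anchor : True := trivial

end Summit.Parity.GeneralizedHardyLittlewood.Cruxes.TypeI2Dilated.PeelToDrappeau

end
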